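import Summits.ValiantsHypothesis.ValiantsHypothesis.Theorems.VPBoundarySquareBorderWindowLST
import Summits.ValiantsHypothesis.ValiantsHypothesis.Theorems.SuccinctLiftSmlAnyFieldBDS
import HarnessLib

/-!
# The VP border window at the Bhargav–Dutta–Saxena slope: BORDER circuits over ANY field, `σ ≤ 18/25`

Support file of route `VPBoundarySquare` (lineage `decomp-val-lens-3`, generation 31, stage 2 of the
critic's CALL of OFFER O6): the Bhargav–Dutta–Saxena twin of
`VPBoundarySquare.immBorderHard_anyField` (stage 1, slope `σ < 1/2`).  For every field `F`, every slope
`25 p ≤ 18 q` and every `c`, for all large `m`, `IMM_{m,⌊√⌊log₂ m⌋⌋}` is NOT in the BORDER of the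
class of circuits over `F((ε))` with at most `m^c + c` wires and product depth
`≤ ⌊p·⌊log₂⌊log₂⌊log₂ m⌋⌋⌋/q⌋ + c` — in the tree's currency
`borderClass F (productDepthEdgeClass F((ε)) …)` (Andrews–Forbes Def. 2.1), no new definitions.

BORDER = EXACT on this window: statement and threshold are those of lens 2's
`SuccinctLiftSmlAnyFieldBDS.immHard_anyField_bds` with `D.Computes IMM` weakened to
`D.eval = IMM + O(ε)`.  The open end of the depth dial (`σ ∈ (18/25, 1]`) is the same for border and
for exact computation and is route `DepthWindow`'s budget, not this file's.

## Proof (same proofs, run over the field `F((ε))`)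

* `homBds_border` — the field-generic BDS engine `DepthWindow.BDS.homBds` (continued-fraction spacing
  law, measure bound `DepthWindow.Law.relRank_eval_le_law`, CALLED as it stands over `F((ε))`), with the
  one exact step `ρ(C.eval) = P_w` replaced by Andrews–Forbes Lemma 6.2
  (`BorderLST.relRank_le_of_polyOrdGE`: `relrk_F(P_w) ≤ relrk_{F((ε))}(ρ(C.eval))` when
  `ρ(C.eval) = P_w + O(ε)`; the two-letter word substitution has coefficients `0, 1`,
  `map_wordSubst_gen` / `map_wordPoly_gen` below).
* `homBds_coreK_border` — lens 2's `homBds_coreK` (the fit arithmetic), verbatim on the border engine.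
* `immBorderHard_anyField_bds` — prune (`exists_size_le_edgeSize`), set-multilinearise at low depth over
  `F((ε))` (`SuccinctLiftSmlCircuit.exists_sml_circuit`, Forbes CCC 2024: depth `× 2`, size `× γ(d) ≤ m²`,
  homogeneous gate values, every characteristic; the projection keeps `O(ε)` terms `O(ε)`:
  `VPBoundarySquare.polyOrdGE_smlProj`), then `homBds_coreK_border` at the doubled slope `2p/q ≤ 36/25`
  past `DepthWindow.BDS.fit_slope`.

Placement: border × any field × BDS slope is the composition of [AndrewsForbes2022, §6.1, Lemma 6.2,
Cor. 6.5] (border LST, char 0 as printed; the proof is characteristic-free), [Forbes2024LowDepth,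
Thm. 1, Cor. 2] (any field, exact) and [BhargavDuttaSaxena2024, Thm. 1.4, Rem. 1.5] (the slope, exact);
the composite is folklore-by-the-same-proofs and was not located in print — here it is kernel-checked.

[cite: AndrewsForbes2022, Lemma 6.2, Cor. 6.5] [cite: Forbes2024LowDepth, Thm. 1, Cor. 2, §1.2]
[cite: BhargavDuttaSaxena2024, Thm. 1.4, Lemma 4.3, Rem. 1.5] [cite: LimayeSrinivasanTavenas2025, Lemma 8, Cor. 4]
-/

-- layout Summits/ValiantsHypothesis/ValiantsHypothesis forces the duplicated namespace component
set_option linter.dupNamespace false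

namespace Summit.ValiantsHypothesis.ValiantsHypothesis.Theorems.VPBoundarySquare

open MvPolynomial Real Literature.Computability.AlgebraicComplexity ArithCircuit
open Literature.Computability.AlgebraicComplexity.GenWord
open Literature.Computability.AlgebraicComplexity.BorderLST
open Summit.ValiantsHypothesis.ValiantsHypothesis.Theorems.DepthWindow
open Summit.ValiantsHypothesis.ValiantsHypothesis.Theorems.DepthWindow.Law
open Summit.ValiantsHypothesis.ValiantsHypothesis.Theorems.DepthWindow.BDS
open Summit.ValiantsHypothesis.ValiantsHypothesis.Theorems.SuccinctLiftSmlCircuit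
open Summit.ValiantsHypothesis.ValiantsHypothesis.Theorems.SuccinctLiftSmlAnyField

noncomputable section

universe u

/-! ### Base change of the two-letter word substitution -/

/-- The general-letter-size word substitution `ρ` has coefficients `0, 1`: it commutes with any change
of scalars. [cite: LimayeSrinivasanTavenas2025, Lemma 8] [cite: BhargavDuttaSaxena2024, §4] -/
theorem map_wordSubst_gen {d : ℕ} (sz : Fin d → ℕ) (pos : Fin d → Bool) (K : Type*) [CommSemiring K]
    {n : ℕ} (hn : ∀ t ≤ d, 2 ^ overLen sz pos t ≤ n) {L : Type*} [CommSemiring L] (φ : K →+* L)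
    (v : Fin d × Fin n × Fin n) :
    MvPolynomial.map φ (wordSubst sz pos K hn v) = wordSubst sz pos L hn v := by
  unfold wordSubst LayeredAutomaton.autSubst
  rw [map_sum]
  refine Finset.sum_congr rfl fun b _ => ?_
  split_ifs <;> simp

/-- The general-letter-size word polynomial `P_w` has coefficients `0, 1`: it commutes with any change
of scalars. [cite: LimayeSrinivasanTavenas2025, §2.2] [cite: BhargavDuttaSaxena2024, §4] -/
theorem map_wordPoly_gen {d : ℕ} (sz : Fin d → ℕ) (pos : Fin d → Bool) (K : Type*) [CommSemiring K]
    {L : Type*} [CommSemiring L] (φ : K →+* L) :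
    MvPolynomial.map φ (wordPoly sz pos K) = wordPoly sz pos L := by
  unfold wordPoly
  rw [map_sum]
  refine Finset.sum_congr rfl fun w _ => ?_
  split_ifs <;> simp [map_prod]

/-! ### The BDS engine on BORDER circuits (`DepthWindow.BDS.homBds`, `+ O(ε)`) -/

/-- **BDS for homogeneous BORDER circuits at fixed parameters**: over any field `F`, a circuit over
`F((ε))` of product-depth `≤ Δ` (`1 ≤ Δ`) all of whose gate values are homogeneous, computing
`IMM_{n,d} + O(ε)`, with `32 ≤ λ`, `λ^{F_{Δ+2}} ≤ λ·d` and `4 d ≤ ⌊log₂ n⌋ = L`, satisfies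
`2^{L(λ-32)/128} ≤ (s d^d + 1)^Δ`.  Proof = `DepthWindow.BDS.homBds` with the spacing-law engine
`relRank_eval_le_law` run over the field `F((ε))` and the exact step `ρ(C.eval) = P_w` replaced by
`relrk_F(P_w) ≤ relrk_{F((ε))}(ρ(C.eval))` (Andrews–Forbes Lemma 6.2).
[cite: BhargavDuttaSaxena2024, Lemma 4.3] [cite: AndrewsForbes2022, Lemma 6.2] -/
theorem homBds_border (F : Type u) [Field F] {Δ : ℕ} (hΔ : 1 ≤ Δ) (n d lam : ℕ) (hd1 : 1 ≤ d)
    (hlam : 32 ≤ lam) (hfit : lam ^ Nat.fib (Δ + 2) ≤ lam * d) (hdn : 4 * d ≤ Nat.log 2 n)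
    (C : ArithCircuit (LaurentSeries F) (Fin d × Fin n × Fin n)) (hCΔ : C.productDepth ≤ Δ)
    (hhom : ∀ v ∈ ArithCircuit.gateValues C.gates, ∃ e : ℕ, v.IsHomogeneous e)
    (hC : PolyOrdGE 1 (C.eval - MvPolynomial.map (algebraMap F (LaurentSeries F)) (immPoly n d F))) :
    (2 : ℝ) ^ ((Nat.log 2 n : ℝ) * ((lam : ℝ) - 32) / 128) ≤ ((C.size * d ^ d + 1 : ℕ) : ℝ) ^ Δ := by
  obtain ⟨Δ, rfl⟩ : ∃ Δ', Δ = Δ' + 1 := ⟨Δ - 1, by omega⟩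
  set L := Nat.log 2 n with hL
  have hL1 : 4 ≤ L := le_trans (by omega) hdn
  have hn0 : n ≠ 0 := by
    rintro rfl
    rw [Nat.log_zero_right] at hL
    omega
  have h2L : 2 ^ L ≤ n := Nat.pow_log_le_self 2 hn0
  -- the continued-fraction parameters
  obtain ⟨p, q, b, c, hb0, hb1, hbmono, hbpow, hp1, hlp, -, hq2b, -, hlaw, hstep, hbot⟩ :=
    exists_params lam Δ (by omega)
  have hlam0 : 0 < lam := by omega
  have hbΔ : b (Δ + 1) ≤ d := Nat.le_of_mul_le_mul_left ((hbpow (Δ + 1)).trans hfit) hlam0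
  have hpq : p ≤ q := le_trans (Nat.le_mul_of_pos_left p hlam0) hlp
  have hq1 : 1 ≤ q := hp1.trans hpq
  have hqL : q ≤ L := by omega
  have hbge : ∀ m, 1 ≤ b m := fun m => hb0 ▸ hbmono (Nat.zero_le m)
  rw [hb1] at hbot
  -- `t = ⌊L/q⌋`, `k = qt ∈ [L/2, L]`
  set t := L / q with ht
  have hkL : q * t ≤ L := by rw [ht, mul_comm]; exact Nat.div_mul_le_self L q
  have hkL2 : L ≤ 2 * (q * t) := by
    have h1 : L < q * (L / q + 1) := Nat.lt_mul_div_succ L (show 0 < q by omega)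
    rw [mul_add, mul_one, ← ht] at h1
    omega
  -- the two-letter greedy word `+(q-p)t / -qt` and the word substitution, over the field `F((ε))`
  set kp := (q - p) * t with hkp
  set kn := q * t with hkn
  have hkpn : kp ≤ kn := Nat.mul_le_mul_right t (Nat.sub_le q p)
  set w := greedyWord₂ d kp kn with hw
  set sz := letterSize₂ kp kn w with hsz
  have hover : ∀ t', overLen sz w t' ≤ kn := fun t' => by
    have h := overLen_greedy_le d kp kn t'
    rw [max_eq_right hkpn] at h
    exact h
  have hn' : ∀ t', t' ≤ d → 2 ^ overLen sz w t' ≤ n := fun t' _ =>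
    (Nat.pow_le_pow_right Nat.two_pos ((hover t').trans hkL)).trans h2L
  have hg := isBlockPreserving_wordSubst sz w (LaurentSeries F) hn'
  have hrig := rigid_of_gateValues_gen hg hhom (Δ + 1)
  -- the engine with `θ_0 = 3/2`, `θ_{m+1} = b_{m+1}/2`, `κ_0 = kp`, `κ_{m+1} = t c_m/(2 b_m)`, `ε = 2^{-kn λ/64}`,
  -- over `F((ε))` (lens 4's measure bound, called as it stands)
  have hε0 : (0 : ℝ) < (2 : ℝ) ^ (-(kn : ℝ) * lam / 64) := Real.rpow_pos_of_pos (by norm_num) _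
  have hup := relRank_eval_le_law (P := C) hg hε0 hd1 (Δ := Δ + 1)
    (θ := fun i => if i = 0 then 3 / 2 else (b i : ℝ) / 2)
    (κ := fun i => if i = 0 then (kp : ℝ) else ((t * c (i - 1) : ℕ) : ℝ) / (2 * b (i - 1)))
    (fun i => by
      rcases i with _ | m
      · rw [if_pos rfl]; norm_num
      · rw [if_neg (Nat.succ_ne_zero m)]
        have h1 : lam ≤ b (m + 1) := hb1 ▸ hbmono (show 1 ≤ m + 1 by omega)
        have h2 : (32 : ℝ) ≤ b (m + 1) := by exact_mod_cast hlam.trans h1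
        linarith)
    (fun i hi W hW => by
      rcases i with _ | m
      · rw [if_pos rfl] at hW ⊢
        exact law_level_zero kp kn hkpn w W hW
      · rw [if_neg (Nat.succ_ne_zero m)] at hW ⊢
        simp only [Nat.add_sub_cancel]
        exact law_level_succ t hpq (hbge m) (hlaw m (by omega)) w W hW)
    (fun i hi => by split_ifs <;> positivity)
    (fun i hi => by
      rcases i with _ | m
      · rw [if_pos rfl, if_neg (Nat.succ_ne_zero 0), hb1]
        exact step_level_zero t (by omega) hpq hbot
      · rw [if_neg (Nat.succ_ne_zero m), if_neg (Nat.succ_ne_zero (m + 1))]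
        simp only [Nat.add_sub_cancel]
        exact step_level_succ t (hbge m) (hstep m (by omega)))
    hrig hCΔ
    (by
      rw [if_neg (Nat.succ_ne_zero Δ)]
      have : (b (Δ + 1) : ℝ) ≤ d := by exact_mod_cast hbΔ
      linarith)
  -- `ρ(IMM) = P_w` after base change: the substitution has coefficients in `F`
  have hIMM : aeval (wordSubst sz w (LaurentSeries F) hn')
      (MvPolynomial.map (algebraMap F (LaurentSeries F)) (immPoly n d F)) =
      MvPolynomial.map (algebraMap F (LaurentSeries F)) (wordPoly sz w F) := by
    rw [map_immPoly, aeval_wordSubst_immPoly sz w (LaurentSeries F) hn' hd1, map_wordPoly_gen]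
  -- `ρ(C.eval) = P_w + O(ε)`
  have hE : PolyOrdGE 1 (aeval (wordSubst sz w (LaurentSeries F) hn') C.eval -
      MvPolynomial.map (algebraMap F (LaurentSeries F)) (wordPoly sz w F)) := by
    rw [← hIMM, ← map_sub, MvPolynomial.aeval_eq_bind₁]
    refine hC.bind₁ fun v => ?_
    rw [← map_wordSubst_gen sz w F hn' (algebraMap F (LaurentSeries F)) v]
    exact PolyOrdGE.map_algebraMap _
  -- lower bound over `F` (full rank of `P_w`), transported to `F((ε))` by Lemma 6.2; upper bound over `F((ε))`
  have hlow := relRank_wordPoly_ge sz w F (hover d)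
  have hmid := relRank_le_of_polyOrdGE w Finset.univ (wordPoly sz w F) _ hE
  have h := (hlow.trans hmid).trans hup
  -- solve for the size, verbatim from `DepthWindow.BDS.homBds`
  have h2 : (0 : ℝ) < 2 := by norm_num
  have hmul := mul_le_mul_of_nonneg_right h (Real.rpow_nonneg h2.le ((kn : ℝ) * lam / 64))
  rw [mul_assoc, ← Real.rpow_add h2, ← Real.rpow_add h2] at hmul
  have e1 : -(kn : ℝ) / 2 + (kn : ℝ) * lam / 64 = (kn : ℝ) * ((lam : ℝ) - 32) / 64 := by ring
  have e2 : -(kn : ℝ) * lam / 64 + (kn : ℝ) * lam / 64 = 0 := by ring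
  rw [e1, e2, Real.rpow_zero, mul_one] at hmul
  refine le_trans (Real.rpow_le_rpow_of_exponent_le one_le_two ?_) hmul
  have hknR : (L : ℝ) ≤ 2 * kn := by exact_mod_cast hkL2
  have hl32 : (0 : ℝ) ≤ (lam : ℝ) - 32 := by
    have : (32 : ℝ) ≤ lam := by exact_mod_cast hlam
    linarith
  nlinarith [mul_le_mul_of_nonneg_right hknR hl32]

/-- **The BDS kernel with a free depth parameter, BORDER circuits over ANY field** — lens 2's
`SuccinctLiftSmlAnyFieldBDS.homBds_coreK` with `D.Computes IMM` weakened to `D.eval = IMM + O(ε)`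
(`D` over `F((ε))`): with `L = ⌊log₂ m⌋`, `d = ⌊√L⌋`, `Δ ≥ 2`, `(256(c+2)Δ)^{F_{Δ+2}} ≤ ⌊√L⌋`,
`4⌊√L⌋ ≤ L`, such a circuit with homogeneous gate values and product depth `≤ Δ` has `> m^c + c`
gates.  The fit arithmetic is verbatim. [cite: BhargavDuttaSaxena2024, Thm. 1.4, Rem. 1.5]
[cite: AndrewsForbes2022, Lemma 6.2] [cite: Forbes2024LowDepth, §1.2] -/
theorem homBds_coreK_border (F : Type u) [Field F] (c Δ m : ℕ) {d L : ℕ} (hL : L = Nat.log 2 m)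
    (hd : d = Nat.sqrt L) (hΔ2 : 2 ≤ Δ)
    (hfit : (256 * (c + 2) * Δ) ^ Nat.fib (Δ + 2) ≤ Nat.sqrt L) (h4 : 4 * Nat.sqrt L ≤ L)
    (D : ArithCircuit (LaurentSeries F) (Fin d × Fin m × Fin m))
    (hhom : ∀ v ∈ ArithCircuit.gateValues D.gates, ∃ e : ℕ, v.IsHomogeneous e)
    (hD : PolyOrdGE 1 (D.eval - MvPolynomial.map (algebraMap F (LaurentSeries F)) (immPoly m d F)))
    (hpd : D.productDepth ≤ Δ) :
    m ^ c + c < D.size := by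
  set lam := 256 * (c + 2) * Δ with hlam
  have hlam32 : 32 ≤ lam := by rw [hlam]; nlinarith
  have hdd : d * d ≤ L := by rw [hd]; exact Nat.sqrt_le L
  have hd4 : 4 * d ≤ L := by rw [hd]; exact h4
  have hd1 : 1 ≤ d := by
    have h1 : 1 ≤ lam ^ Nat.fib (Δ + 2) := Nat.one_le_pow _ _ (by omega)
    rw [hd]; omega
  have hL4 : 4 ≤ L := by omega
  have hfit' : lam ^ Nat.fib (Δ + 2) ≤ lam * d := by
    calc lam ^ Nat.fib (Δ + 2) ≤ d := by rw [hd]; exact hfit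
      _ ≤ lam * d := Nat.le_mul_of_pos_left d (by omega)
  have hdn : 4 * d ≤ Nat.log 2 m := hL ▸ hd4
  have h := homBds_border F (Δ := Δ) (by omega) m d lam hd1 hlam32 hfit' hdn D hpd hhom hD
  rw [← hL] at h
  have hE1 : 1 ≤ 2 * (c + 2) * Δ := by nlinarith
  have hexp : ((((2 * (c + 2) * Δ - 1) * L : ℕ)) : ℝ) ≤ (L : ℝ) * ((lam : ℝ) - 32) / 128 := by
    have hlamR : (lam : ℝ) = 256 * ((c : ℝ) + 2) * Δ := by rw [hlam]; push_cast; ring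
    have hLR : (0 : ℝ) ≤ L := Nat.cast_nonneg _
    push_cast [Nat.cast_sub hE1]
    rw [hlamR]
    nlinarith [hLR]
  have hN : 2 ^ ((2 * (c + 2) * Δ - 1) * L) ≤ (D.size * d ^ d + 1) ^ Δ := by
    have h1 := (Real.rpow_le_rpow_of_exponent_le one_le_two hexp).trans h
    rw [Real.rpow_natCast] at h1
    exact_mod_cast h1
  by_contra hs
  push Not at hs
  have hm2 : m < 2 ^ (L + 1) := by rw [hL]; exact Nat.lt_pow_succ_log_self one_lt_two m
  have hmc : m ^ c ≤ 2 ^ ((L + 1) * c) := by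
    rw [pow_mul]; exact Nat.pow_le_pow_left hm2.le c
  have hmcc : m ^ c + c ≤ 2 ^ ((L + 1) * c + c) := by
    have h1 : c + 1 ≤ 2 ^ c := Nat.lt_two_pow_self
    have h2 : 1 ≤ 2 ^ ((L + 1) * c) := Nat.one_le_two_pow
    calc m ^ c + c ≤ 2 ^ ((L + 1) * c) + 2 ^ ((L + 1) * c) * c := by nlinarith
      _ = 2 ^ ((L + 1) * c) * (c + 1) := by ring
      _ ≤ 2 ^ ((L + 1) * c) * 2 ^ c := Nat.mul_le_mul_left _ h1
      _ = 2 ^ ((L + 1) * c + c) := by rw [← pow_add]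
  have hddL : d ^ d ≤ 2 ^ L := by
    calc d ^ d ≤ (2 ^ d) ^ d := Nat.pow_le_pow_left (Nat.lt_two_pow_self).le d
      _ = 2 ^ (d * d) := by rw [← pow_mul]
      _ ≤ 2 ^ L := Nat.pow_le_pow_right (by norm_num) hdd
  have hup : D.size * d ^ d + 1 ≤ 2 ^ ((L + 1) * c + c + L + 1) := by
    have h1 : D.size * d ^ d ≤ 2 ^ ((L + 1) * c + c + L) := by
      rw [pow_add]; exact Nat.mul_le_mul (hs.trans hmcc) hddL
    have h2 : 1 ≤ 2 ^ ((L + 1) * c + c + L) := Nat.one_le_two_pow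
    rw [pow_succ]; omega
  have hupΔ : (D.size * d ^ d + 1) ^ Δ ≤ 2 ^ (((L + 1) * c + c + L + 1) * Δ) := by
    rw [pow_mul]; exact Nat.pow_le_pow_left hup Δ
  have hfin := (Nat.pow_le_pow_iff_right (by norm_num)).1 (hN.trans hupΔ)
  zify [hE1] at hfin
  have hcZ : (0 : ℤ) ≤ c := by exact_mod_cast Nat.zero_le c
  have hΔZ : (2 : ℤ) ≤ Δ := by exact_mod_cast hΔ2
  have hLZ : (4 : ℤ) ≤ L := by exact_mod_cast hL4
  nlinarith [mul_nonneg (mul_nonneg hcZ (by linarith : (0 : ℤ) ≤ Δ)) (by linarith : (0 : ℤ) ≤ (L : ℤ) - 2),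
    mul_nonneg (by linarith : (0 : ℤ) ≤ (Δ : ℤ) - 2) (by linarith : (0 : ℤ) ≤ 3 * (L : ℤ) - 1)]

/-! ### ★ The theorem: border BDS over any field, general circuits, relative depth `σ ≤ 18/25` -/

/-- ★ **Bhargav–Dutta–Saxena for BORDER circuits over ANY field, general circuits, every slope
`σ ≤ 18/25`** (the border twin of `SuccinctLiftSmlAnyFieldBDS.immHard_anyField_bds`): for every field
`F`, `25 p ≤ 18 q` and every `c`, for all large `m`, `IMM_{m,⌊√⌊log₂ m⌋⌋}` is NOT in the border of the
class of circuits over `F((ε))` with at most `m^c + c` wires and product depth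
`≤ ⌊p·⌊log₂⌊log₂⌊log₂ m⌋⌋⌋/q⌋ + c` (Andrews–Forbes Def. 2.1; unbounded fan-in, arbitrary constants,
NO homogeneity assumption).  Route: prune, set-multilinearise at low depth over `F((ε))` (Forbes:
depth `× 2`, size `× γ(d) ≤ m²`, homogeneous gate values; `O(ε)` terms stay `O(ε)`), then
`homBds_coreK_border` at the doubled slope `2p/q ≤ 36/25` past `DepthWindow.BDS.fit_slope`.  BORDER =
EXACT on this window: the statement and the threshold are those of `immHard_anyField_bds`.
[cite: AndrewsForbes2022, Lemma 6.2, Cor. 6.5] [cite: Forbes2024LowDepth, Thm. 1, §1.2]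
[cite: BhargavDuttaSaxena2024, Thm. 1.4, Rem. 1.5] [cite: LimayeSrinivasanTavenas2025, Cor. 4] -/
theorem immBorderHard_anyField_bds (F : Type u) [Field F] {p q : ℕ} (hpq : 25 * p ≤ 18 * q) (c : ℕ) :
    ∃ m₁ : ℕ, ∀ m : ℕ, m₁ ≤ m →
      immPoly m (Nat.sqrt (Nat.log 2 m)) F ∉
        borderClass F (productDepthEdgeClass (LaurentSeries F)
          (Fin (Nat.sqrt (Nat.log 2 m)) × Fin m × Fin m) (m ^ c + c)
          (p * Nat.log 2 (Nat.log 2 (Nat.log 2 m)) / q + c)) := by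
  rcases Nat.eq_zero_or_pos p with rfl | hp
  · -- slope `0` (constant additive depth): already `immBorderHard_anyField` at `p = 0`, `q = 1`
    obtain ⟨m₁, hm₁⟩ := immBorderHard_anyField F (p := 0) (q := 1) (by norm_num) c
    refine ⟨m₁, fun m hm => ?_⟩
    simpa using hm₁ m hm
  have hq : 0 < q := by omega
  obtain ⟨L₀, hL₀⟩ := BDS.fit_slope (2 * p) q (2 * c + 3) (by omega) hq (by omega)
  refine ⟨2 ^ max L₀ 100 + (2 * c + 2), fun m hm hmem => ?_⟩
  have hm' : 2 ^ max L₀ 100 ≤ m := le_trans (Nat.le_add_right _ _) hm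
  have hmc : 2 * c + 2 ≤ m := le_trans (Nat.le_add_left _ _) hm
  have h100 : 2 ^ 100 ≤ m := le_trans (Nat.pow_le_pow_right (by norm_num) (le_max_right _ _)) hm'
  have hm0 : m ≠ 0 := by omega
  have hL100 : 100 ≤ Nat.log 2 m := Nat.le_log_of_pow_le (by norm_num) h100
  have h2L : 2 ^ Nat.log 2 m ≤ m := Nat.pow_log_le_self 2 hm0
  -- the border circuit `D` (computing `h = IMM + O(ε)` with `≤ m^c + c` wires), pruned and set-multilinearised
  obtain ⟨h, ⟨D, hDh, hpd, hDs⟩, hord⟩ := hmem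
  obtain ⟨D', hD'e, hD'd, hD'w, hD's⟩ := exists_size_le_edgeSize D
  obtain ⟨H, hH, hhom, hHpd, hHsize, -⟩ :=
    exists_sml_circuit (Prod.fst : Fin (Nat.sqrt (Nat.log 2 m)) × Fin m × Fin m → Fin _) D'
  -- the set-multilinear projection fixes `IMM` and keeps `O(ε)` terms `O(ε)`
  have hproj : smlProj (Prod.fst : Fin (Nat.sqrt (Nat.log 2 m)) × Fin m × Fin m → Fin _) Finset.univ
      (MvPolynomial.map (algebraMap F (LaurentSeries F)) (immPoly m (Nat.sqrt (Nat.log 2 m)) F)) =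
      MvPolynomial.map (algebraMap F (LaurentSeries F)) (immPoly m (Nat.sqrt (Nat.log 2 m)) F) := by
    rw [map_immPoly]
    exact IsSetMultilinear.smlProj_eq _ (isSetMultilinear_immPoly (LaurentSeries F) m _)
  have hHc : PolyOrdGE 1 (H.eval -
      MvPolynomial.map (algebraMap F (LaurentSeries F)) (immPoly m (Nat.sqrt (Nat.log 2 m)) F)) := by
    rw [show H.eval = _ from hH, hD'e, show D.eval = h from hDh, ← hproj, ← map_sub]
    exact polyOrdGE_smlProj _ _ hord
  have hHpd' : H.productDepth ≤ 2 * p * Nat.log 2 (Nat.log 2 (Nat.log 2 m)) / q + (2 * c + 3) := by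
    have h1 : 2 * (p * Nat.log 2 (Nat.log 2 (Nat.log 2 m)) / q) ≤
        2 * p * Nat.log 2 (Nat.log 2 (Nat.log 2 m)) / q := by
      rw [mul_assoc]; exact Nat.mul_div_le_mul_div_assoc _ _ _
    calc H.productDepth ≤ 2 * D'.productDepth := hHpd
      _ ≤ 2 * D.productDepth := Nat.mul_le_mul_left 2 hD'd
      _ ≤ 2 * (p * Nat.log 2 (Nat.log 2 (Nat.log 2 m)) / q + c) := Nat.mul_le_mul_left 2 hpd
      _ = 2 * (p * Nat.log 2 (Nat.log 2 (Nat.log 2 m)) / q) + 2 * c := by rw [mul_add]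
      _ ≤ _ := add_le_add h1 (by omega)
  have hLge : L₀ ≤ Nat.log 2 m :=
    le_trans (le_max_left _ _) (Nat.le_log_of_pow_le (by norm_num) hm')
  obtain ⟨hΔ2, hfit, h4⟩ := hL₀ (Nat.log 2 m) hLge
  have hcore := homBds_coreK_border F (2 * c + 3) _ m rfl rfl hΔ2 hfit h4 H hhom hHc hHpd'
  -- the size bookkeeping, verbatim from `immHard_anyField_bds`
  have hγ : gamma (Nat.sqrt (Nat.log 2 m)) ≤ m * m :=
    (gamma_le (Nat.log 2 m) _ rfl hL100).trans (Nat.mul_le_mul h2L h2L)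
  have hDD : D'.edgeSize + D'.size ≤ 2 * (m ^ c + c) := by omega
  have hsz : H.size ≤ 2 * (m ^ c + c) * (m * m) := hHsize.trans (Nat.mul_le_mul hDD hγ)
  have hm1 : 1 ≤ m := by omega
  have hmc1 : 1 ≤ m ^ c := Nat.one_le_pow _ _ hm1
  have e1 : c * (m * m) ≤ c * m ^ c * (m * m) := by
    have h1 : c * 1 ≤ c * m ^ c := Nat.mul_le_mul_left c hmc1
    rw [mul_one] at h1
    exact Nat.mul_le_mul_right _ h1
  have hfin : 2 * (m ^ c + c) * (m * m) ≤ m ^ (2 * c + 3) + (2 * c + 3) := by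
    calc 2 * (m ^ c + c) * (m * m) = 2 * m ^ c * (m * m) + 2 * (c * (m * m)) := by ring
      _ ≤ 2 * m ^ c * (m * m) + 2 * (c * m ^ c * (m * m)) :=
          Nat.add_le_add_left (Nat.mul_le_mul_left 2 e1) _
      _ = (2 + 2 * c) * m ^ c * (m * m) := by ring
      _ ≤ m * m ^ c * (m * m) := Nat.mul_le_mul_right _ (Nat.mul_le_mul_right _ (by omega))
      _ = m ^ (c + 3) := by ring
      _ ≤ m ^ (2 * c + 3) := Nat.pow_le_pow_right hm1 (by omega)
      _ ≤ _ := Nat.le_add_right _ _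
  omega

/-- ★ **The same in circuit language**: for every field `F`, `25 p ≤ 18 q` and `c`, for all large `m`,
every circuit `D` over `F((ε))` computing `IMM_{m,⌊√⌊log₂ m⌋⌋} + O(ε)` coefficientwise (`PolyOrdGE 1`) in
product depth `≤ ⌊p·⌊log₂⌊log₂⌊log₂ m⌋⌋⌋/q⌋ + c` has more than `m^c + c` wires — literally the statement
of `immHard_anyField_bds` with `D.Computes IMM` weakened to `D.eval = IMM + O(ε)`.
[cite: AndrewsForbes2022, Cor. 6.5] [cite: Forbes2024LowDepth, Thm. 1] [cite: BhargavDuttaSaxena2024, Thm. 1.4] -/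
theorem immBorderHard_anyField_bds_circuit (F : Type u) [Field F] {p q : ℕ} (hpq : 25 * p ≤ 18 * q)
    (c : ℕ) :
    ∃ m₁ : ℕ, ∀ m : ℕ, m₁ ≤ m →
      ∀ D : ArithCircuit (LaurentSeries F) (Fin (Nat.sqrt (Nat.log 2 m)) × Fin m × Fin m),
        PolyOrdGE 1 (D.eval -
          MvPolynomial.map (algebraMap F (LaurentSeries F)) (immPoly m (Nat.sqrt (Nat.log 2 m)) F)) →
        D.productDepth ≤ p * Nat.log 2 (Nat.log 2 (Nat.log 2 m)) / q + c → m ^ c + c < D.edgeSize := by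
  obtain ⟨m₁, hm₁⟩ := immBorderHard_anyField_bds F hpq c
  refine ⟨m₁, fun m hm D hD hpd => ?_⟩
  by_contra hle
  push Not at hle
  exact hm₁ m hm ⟨D.eval, ⟨D, rfl, hpd, hle⟩, hD⟩

end

end Summit.ValiantsHypothesis.ValiantsHypothesis.Theorems.VPBoundarySquare
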